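import Summits.CriticalPhenomena.SAWScalingLimit.Theses.SAWPhaseRetrieval
import Literature.Probability.LatticeModels.TriangularLatticeProofs
import Literature.Barriers.CriticalPhenomena.ParafermionicHalfCauchyRiemann

/-!
# Refutation of `SAWPhaseRetrieval.RetrievalStability` (stmt-CriticalPhenomena-8312)

The typed statement quantifies over ALL compact `K` (with an `r`-thickening inside `Ω`) but asks for
ONE scalar `s > 0` normalising `|G|` on all of `K`.  For a DISCONNECTED `K` this fails: take
`Ω = {Re z ≠ 0}`, `L = 0`, `Λ δ =` the faces in a box of size `⌈1/δ²⌉` whose centre has `|Re| ≥ 1`,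
`K = closedBall (-3) 1 ∪ closedBall 3 1`, `r = 1`, `η = 1/8`, and the field `G = 1` on mid-edges left of
the imaginary axis, `G = 2` on the right.  The three mid-edges at a face are within real-part distance
`1/4` of its centre, so `G` is constant around every face of `Λ δ` and the DCS vertex relation reduces
to the barycentre identity of the honeycomb; the phases of `G` are exactly the target phases; but each
ball carries `≥ 12k²` mid-edges at `δ = 1/(4k)` while `|1/s - 1| + |2/s - 1| ≥ 1/2` for every `s > 0`,
so `δ² Σ ≥ 3/16 > η`.  Repaired as `RetrievalStabilityR` (+ `IsPreconnected K`); decl re-created below.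
-/

open Literature.Probability.LatticeModels Literature.Probability.RandomPlanarGeometry.SAW Literature.Barriers.CriticalPhenomena

/-- PRIVATE re-creation (route namespace stays free; a refuted statement, NOT a cited fact) of the
route decl DROPPED at rev 1, 2026-08-15T16:32:30Z, after its refutation below: the recorded signature
of stmt-CriticalPhenomena-8312 verbatim (names shortened under the `open`s above; repaired crux
`RetrievalStabilityR` adds `IsPreconnected K`), so the append-only refuting theorem keeps elaborating. -/
private def Summit.CriticalPhenomena.SAWScalingLimit.Theses.SAWPhaseRetrieval.RetrievalStability :
    Prop :=
  ∀ (Ω : Set ℂ) (Λ : ℝ → Finset HexVertex) (L : ℂ → ℂ),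
    let region : ℝ → Set ℂ → Set (Sym2 HexVertex) :=
      fun δ K => {e | e ∈ hexDomainMidEdges (Λ δ) ∧ (δ : ℂ) * hexMidpoint e ∈ K};
    IsOpen Ω → DifferentiableOn ℂ L Ω →
    (∀ K : Set ℂ, IsCompact K → K ⊆ Ω → ∀ᶠ δ : ℝ in nhdsWithin 0 (Set.Ioi 0),
      ∀ v : HexVertex, (δ : ℂ) * hexCenter v ∈ K → v ∈ Λ δ) →
    ∀ K : Set ℂ, IsCompact K → ∀ r : ℝ, 0 < r → Metric.cthickening r K ⊆ Ω → ∀ η : ℝ, 0 < η →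
    ∃ ε : ℝ, 0 < ε ∧ ∀ᶠ δ : ℝ in nhdsWithin 0 (Set.Ioi 0), ∀ G : Sym2 HexVertex → ℂ,
      (∀ v ∈ Λ δ, ∀ p q r : HexVertex, hexGraph.Adj v p → hexGraph.Adj v q → hexGraph.Adj v r →
        p ≠ q → q ≠ r → p ≠ r → (hexMidpoint s(v, p) - hexCenter v) * G s(v, p) +
          (hexMidpoint s(v, q) - hexCenter v) * G s(v, q) +
          (hexMidpoint s(v, r) - hexCenter v) * G s(v, r) = 0) →
      (∀ e ∈ region δ (Metric.cthickening r K), G e ≠ 0 ∧ ‖G e / ((‖G e‖ : ℝ) : ℂ) -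
        Complex.exp (Complex.I * (5 / 8 : ℂ) * (((L ((δ : ℂ) * hexMidpoint e)).im : ℝ) : ℂ))‖ ≤ ε) →
      ∃ s : ℝ, 0 < s ∧ δ ^ 2 * (∑ᶠ e ∈ region δ K,
        |‖G e‖ / s - ‖Complex.exp ((5 / 8 : ℂ) * L ((δ : ℂ) * hexMidpoint e))‖|) ≤ η

namespace Summit.CriticalPhenomena.SAWScalingLimit.Theorems

set_option maxHeartbeats 1600000 in
/-- Refutes `SAWPhaseRetrieval.RetrievalStability` (stmt-CriticalPhenomena-8312): the conditional
stability statement is false as typed because the compact set `K` may be disconnected while a single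
scalar `s` must normalise `|G|` on all of `K`; witness `Ω = {Re ≠ 0}`, `L = 0`, `K` = two unit balls
about `±3`, `G = 1`/`2` on the two sides of the imaginary axis (a solution of every vertex relation
with exact target phases), `η = 1/8`, `δ = 1/(4k)`. [folklore] -/
theorem SAWPhaseRetrievalRetrievalStability_refuted :
    ¬ Summit.CriticalPhenomena.SAWScalingLimit.Theses.SAWPhaseRetrieval.RetrievalStability := by
  intro h
  set Gcex : Sym2 HexVertex → ℂ := fun e => if (hexMidpoint e).re < 0 then 1 else 2 with hGcex
  have hG : ∀ e, Gcex e = if (hexMidpoint e).re < 0 then 1 else 2 := fun e => by rw [hGcex]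
  clear_value Gcex
  set Lam : ℝ → Finset HexVertex := fun δ =>
    ((box 2 ⌈1 / δ ^ 2⌉₊) ×ˢ (Finset.univ : Finset (Fin 2))).filter (fun v => 1 ≤ |(hexCenter v).re|) with hLam
  have hmemLam : ∀ {δ : ℝ} {v : HexVertex}, v ∈ Lam δ ↔
      (∀ i, -(⌈1 / δ ^ 2⌉₊ : ℤ) ≤ v.1 i ∧ v.1 i ≤ ⌈1 / δ ^ 2⌉₊) ∧ 1 ≤ |(hexCenter v).re| := by
    intro δ v; rw [hLam]; simp
  clear_value Lam
  set famEdge : ℤ × ℤ → Sym2 HexVertex := fun p =>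
    s(((![p.1 - p.2, 2 * p.2] : Site 2), 0), ((![p.1 - p.2, 2 * p.2] : Site 2) - HexKernel.unitE1, 1)) with hfamEdge
  have hfam : ∀ p : ℤ × ℤ, famEdge p =
      s(((![p.1 - p.2, 2 * p.2] : Site 2), 0), ((![p.1 - p.2, 2 * p.2] : Site 2) - HexKernel.unitE1, 1)) :=
    fun p => by rw [hfamEdge]
  clear_value famEdge
  have hre : ∀ (x : Site 2) (k : Fin 2), (hexCenter (x, k)).re = x 0 + x 1 / 2 + ((k : ℕ) + 1) / 2 := by
    intro x k
    have h3 : ((1 : ℂ) + triZeta).re = 3 / 2 := by simp; norm_num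
    have h3' : ((1 : ℂ) + triZeta).im = Real.sqrt 3 / 2 := by simp
    have : (triEmbed x).re = x 0 + x 1 / 2 := by simp [triEmbed, Complex.add_re, Complex.mul_re]; ring
    simp [hexCenter, this, Complex.add_re, Complex.mul_re, h3, h3']; ring
  have him : ∀ (x : Site 2) (k : Fin 2),
      (hexCenter (x, k)).im = x 1 * (Real.sqrt 3 / 2) + ((k : ℕ) + 1) * (Real.sqrt 3 / 6) := by
    intro x k
    have h3 : ((1 : ℂ) + triZeta).re = 3 / 2 := by simp; norm_num
    have h3' : ((1 : ℂ) + triZeta).im = Real.sqrt 3 / 2 := by simp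
    have : (triEmbed x).im = x 1 * (Real.sqrt 3 / 2) := by simp [triEmbed, Complex.add_im, Complex.mul_im]
    simp [hexCenter, this, Complex.add_im, Complex.mul_im, h3, h3']; ring
  have hGv : ∀ (v w : HexVertex), w ∈ HexGreen.nbrs v → 1 ≤ |(hexCenter v).re| →
      Gcex s(v, w) = if (hexCenter v).re < 0 then 1 else 2 := by
    rintro ⟨y, i⟩ ⟨z, j⟩ hw hv
    have hd : |(hexCenter (z, j)).re - (hexCenter (y, i)).re| ≤ 1 / 2 := by
      fin_cases i
      · simp only [Fin.zero_eta, HexGreen.nbrs_up, Finset.mem_insert, Finset.mem_singleton,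
          Prod.mk.injEq] at hw
        rcases hw with ⟨rfl, rfl⟩ | ⟨rfl, rfl⟩ | ⟨rfl, rfl⟩ <;>
          · simp only [hre, Pi.sub_apply, Pi.single_apply]
            simp
            rw [abs_le]; constructor <;> linarith
      · simp only [Fin.mk_one, HexGreen.nbrs_down, Finset.mem_insert, Finset.mem_singleton,
          Prod.mk.injEq] at hw
        rcases hw with ⟨rfl, rfl⟩ | ⟨rfl, rfl⟩ | ⟨rfl, rfl⟩ <;>
          · simp only [hre, Pi.add_apply, Pi.single_apply]
            simp
            rw [abs_le]; constructor <;> linarith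
    have hm : (hexMidpoint s((y, i), (z, j))).re = ((hexCenter (y, i)).re + (hexCenter (z, j)).re) / 2 := by
      simp [hexMidpoint_mk, Complex.add_re]
    obtain ⟨hd1, hd2⟩ := abs_le.1 hd
    rw [hG, hm]
    by_cases hneg : (hexCenter (y, i)).re < 0
    · have h1 : (hexCenter (y, i)).re ≤ -1 := by cases abs_cases (hexCenter (y, i)).re <;> linarith
      rw [if_pos (by linarith), if_pos hneg]
    · have h1 : 1 ≤ (hexCenter (y, i)).re := by cases abs_cases (hexCenter (y, i)).re <;> linarith
      rw [if_neg (by linarith), if_neg hneg]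
  have hSVR : ∀ δ, SatisfiesVertexRelations (Lam δ) Gcex := by
    intro δ
    rw [HexGreen.satisfiesVertexRelations_iff_sum]
    rintro ⟨y, i⟩ hv
    have hv1 := (hmemLam.1 hv).2
    fin_cases i
    · rw [Fin.zero_eta] at hv1 ⊢
      rw [HexGreen.sum_nbrs_term_up]
      simp only [HexKernel.term]
      rw [hGv _ _ (by simp [HexGreen.nbrs_up]) hv1, hGv _ (y - HexKernel.unitE0, 1) (by simp [HexGreen.nbrs_up]) hv1,
        hGv _ (y - HexKernel.unitE1, 1) (by simp [HexGreen.nbrs_up]) hv1]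
      simp only [hexMidpoint_mk, HexKernel.hexCenter_mk, HexKernel.triEmbed_sub, HexKernel.triEmbed_unitE0,
        HexKernel.triEmbed_unitE1, Fin.val_zero, Fin.val_one, Nat.cast_zero, Nat.cast_one]; ring
    · rw [Fin.mk_one] at hv1 ⊢
      rw [HexGreen.sum_nbrs_term_down]
      simp only [HexKernel.term]
      rw [hGv _ _ (by simp [HexGreen.nbrs_down]) hv1, hGv _ (y + HexKernel.unitE0, 0) (by simp [HexGreen.nbrs_down]) hv1,
        hGv _ (y + HexKernel.unitE1, 0) (by simp [HexGreen.nbrs_down]) hv1]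
      simp only [hexMidpoint_mk, HexKernel.hexCenter_mk, triEmbed_add, HexKernel.triEmbed_unitE0,
        HexKernel.triEmbed_unitE1, Fin.val_zero, Fin.val_one, Nat.cast_zero, Nat.cast_one]; ring
  have hexh : ∀ K : Set ℂ, IsCompact K → K ⊆ {z : ℂ | z.re ≠ 0} →
      ∀ᶠ δ : ℝ in nhdsWithin 0 (Set.Ioi 0), ∀ v : HexVertex, (δ : ℂ) * hexCenter v ∈ K → v ∈ Lam δ := by
    intro K hK hKO
    rcases K.eq_empty_or_nonempty with rfl | hne
    · exact Filter.Eventually.of_forall (fun δ v hv => absurd hv (Set.notMem_empty _))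
    obtain ⟨z₀, hz₀, hmin⟩ := hK.exists_isMinOn hne
      ((continuous_abs.comp Complex.continuous_re).continuousOn : ContinuousOn (fun z : ℂ => |z.re|) K)
    have hκ : 0 < |z₀.re| := abs_pos.mpr (hKO hz₀)
    obtain ⟨R, hR⟩ := hK.isBounded.exists_norm_le
    have hR0 : 0 ≤ R := (norm_nonneg _).trans (hR z₀ hz₀)
    have hδ₀ : (0 : ℝ) < min |z₀.re| (1 / (2 * R + 6)) := lt_min hκ (by positivity)
    filter_upwards [Ioo_mem_nhdsGT hδ₀] with δ hδ
    obtain ⟨hδpos, hδlt⟩ := hδ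
    have hδκ : δ < |z₀.re| := lt_of_lt_of_le hδlt (min_le_left _ _)
    have hδR : δ < 1 / (2 * R + 6) := lt_of_lt_of_le hδlt (min_le_right _ _)
    intro v hv; rw [hmemLam]
    have hcre : ((δ : ℂ) * hexCenter v).re = δ * (hexCenter v).re := Complex.re_ofReal_mul _ _
    constructor
    · intro i
      have hn : ‖(δ : ℂ) * hexCenter v‖ ≤ R := hR _ hv
      rw [norm_mul, Complex.norm_real, Real.norm_eq_abs, abs_of_pos hδpos] at hn
      have hc : ‖hexCenter v‖ ≤ R / δ := by rw [le_div_iff₀ hδpos]; linarith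
      -- the cell is controlled by the face centre
      have hz : ‖triZeta‖ = 1 := by
        have := normSq_triZeta
        rw [Complex.normSq_eq_norm_sq] at this
        nlinarith [norm_nonneg triZeta]
      have h2 : ‖((v.2 : ℕ) + 1 : ℂ) * (1 + triZeta) / 3‖ ≤ 2 := by
        rw [norm_div, norm_mul]
        have hk : ‖((v.2 : ℕ) + 1 : ℂ)‖ ≤ 2 := by
          have : ((v.2 : ℕ) : ℝ) ≤ 1 := by exact_mod_cast Nat.lt_succ_iff.mp v.2.isLt
          rw [show ((v.2 : ℕ) + 1 : ℂ) = (((v.2 : ℕ) + 1 : ℝ) : ℂ) by push_cast; ring, Complex.norm_real,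
            Real.norm_eq_abs, abs_of_nonneg (by positivity)]
          linarith
        have h1z : ‖(1 : ℂ) + triZeta‖ ≤ 2 :=
          (norm_add_le _ _).trans (by rw [hz]; norm_num)
        rw [show ‖(3 : ℂ)‖ = 3 by norm_num, div_le_iff₀ (by norm_num : (0 : ℝ) < 3)]
        nlinarith [norm_nonneg ((v.2 : ℕ) + 1 : ℂ), norm_nonneg ((1 : ℂ) + triZeta)]
      have h4 : triEmbed v.1 = hexCenter v - ((v.2 : ℕ) + 1 : ℂ) * (1 + triZeta) / 3 := by
        rw [show hexCenter v = triEmbed v.1 + ((v.2 : ℕ) + 1 : ℂ) * (1 + triZeta) / 3 from rfl]; ring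
      have ht : ‖triEmbed v.1‖ ≤ R / δ + 2 := by
        rw [h4]; exact (norm_sub_le _ _).trans (by linarith)
      have hx : |(v.1 i : ℝ)| ≤ 2 * (R / δ + 2) := (abs_le_two_mul_norm_triEmbed v.1 i).trans (by linarith)
      have hkey : 2 * (R / δ + 2) ≤ (⌈1 / δ ^ 2⌉₊ : ℝ) := by
        refine le_trans ?_ (Nat.le_ceil _)
        have hδ1 : δ ≤ 1 := by
          have : 1 / (2 * R + 6) ≤ 1 := by rw [div_le_one (by positivity)]; linarith
          linarith
        rw [div_add' _ _ _ hδpos.ne', mul_div_assoc', div_le_div_iff₀ hδpos (by positivity)]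
        have h5 : (2 * R + 6) * δ < 1 := by rwa [lt_div_iff₀ (by positivity), mul_comm] at hδR
        nlinarith [hδpos, hδ1, hR0]
      obtain ⟨hl, hu⟩ := abs_le.1 (hx.trans hkey)
      exact ⟨by exact_mod_cast hl, by exact_mod_cast hu⟩
    · have h1 : |z₀.re| ≤ |((δ : ℂ) * hexCenter v).re| := hmin hv
      rw [hcre, abs_mul, abs_of_pos hδpos] at h1
      by_contra hlt; push Not at hlt
      have : δ * |(hexCenter v).re| ≤ δ * 1 := mul_le_mul_of_nonneg_left hlt.le hδpos.le
      linarith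
  set K : Set ℂ := Metric.closedBall (-3 : ℂ) 1 ∪ Metric.closedBall (3 : ℂ) 1 with hKdef
  have hKc : IsCompact K := (isCompact_closedBall _ _).union (isCompact_closedBall _ _)
  have hthick : Metric.cthickening 1 K ⊆ {z : ℂ | z.re ≠ 0} := by
    intro z hz
    rw [hKc.cthickening_eq_biUnion_closedBall zero_le_one, Set.mem_iUnion₂] at hz
    obtain ⟨x, hx, hzx⟩ := hz
    rw [Metric.mem_closedBall, dist_eq_norm] at hzx
    have h1 : |z.re - x.re| ≤ 1 := by
      have := Complex.abs_re_le_norm (z - x); rw [Complex.sub_re] at this; linarith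
    have h2 : 2 ≤ |x.re| := by
      rcases hx with hx | hx <;> rw [Metric.mem_closedBall, dist_eq_norm] at hx
      · have h' := Complex.abs_re_le_norm (x - (-3))
        have e : (x - (-3 : ℂ)).re = x.re + 3 := by simp
        rw [e] at h'; obtain ⟨-, h4⟩ := abs_le.1 (h'.trans hx); rw [le_abs]; right; linarith
      · have h' := Complex.abs_re_le_norm (x - 3)
        have e : (x - (3 : ℂ)).re = x.re - 3 := by simp
        rw [e] at h'; obtain ⟨h3, -⟩ := abs_le.1 (h'.trans hx); rw [le_abs]; left; linarith
    intro h0; have h0' : z.re = 0 := by simpa using h0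
    rw [h0', zero_sub, abs_neg] at h1; linarith
  obtain ⟨ε, hε, hev⟩ := h {z : ℂ | z.re ≠ 0} Lam (fun _ => (0 : ℂ))
    (isOpen_ne_fun Complex.continuous_re continuous_const) (differentiableOn_const 0) hexh K hKc 1 one_pos
    hthick (1 / 8) (by norm_num)
  have htend : Filter.Tendsto (fun k : ℕ => 1 / (4 * ((k : ℝ) + 1))) Filter.atTop (nhdsWithin 0 (Set.Ioi 0)) := by
    rw [tendsto_nhdsWithin_iff]
    refine ⟨?_, Filter.Eventually.of_forall (fun k => by
      show (0 : ℝ) < 1 / (4 * ((k : ℝ) + 1)); positivity)⟩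
    have h := (tendsto_one_div_add_atTop_nhds_zero_nat).const_mul (1 / 4 : ℝ)
    rw [mul_zero] at h; exact Filter.Tendsto.congr (fun k => by rw [one_div_mul_one_div]) h
  obtain ⟨δ, hP, k, rfl⟩ := (hev.and_frequently
    (htend.frequently (Filter.Frequently.of_forall (fun k => ⟨k, rfl⟩)) :
      ∃ᶠ δ in nhdsWithin (0 : ℝ) (Set.Ioi 0), ∃ k : ℕ, δ = 1 / (4 * ((k : ℝ) + 1)))).exists
  have hne : ∀ e, Gcex e ≠ 0 := fun e => by rw [hG]; split_ifs <;> norm_num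
  have hdiv : ∀ e, Gcex e / ((‖Gcex e‖ : ℝ) : ℂ) = 1 := fun e => by rw [hG]; split_ifs <;> norm_num
  obtain ⟨s, hs, hsum⟩ := hP Gcex (hSVR _) (fun e _ => ⟨hne e, by simpa [hdiv] using hε.le⟩)
  clear hP hev hexh hSVR hthick htend hGv
  simp only [mul_zero, Complex.exp_zero, norm_one] at hsum
  set κ : ℕ := k + 1 with hκ
  have hκ1 : 1 ≤ κ := by omega
  have hκR : ((κ : ℕ) : ℝ) = (k : ℝ) + 1 := by rw [hκ]; push_cast; ring
  set δ : ℝ := 1 / (4 * ((k : ℝ) + 1)) with hδ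
  clear_value κ δ
  have hκpos : (0 : ℝ) < κ := by rw [hκR]; positivity
  have hδκ : δ * (4 * κ) = 1 := by rw [hδ, hκR]; field_simp
  have hceil : ⌈1 / δ ^ 2⌉₊ = 16 * κ ^ 2 := by
    have : 1 / δ ^ 2 = ((16 * κ ^ 2 : ℕ) : ℝ) := by
      push_cast; rw [hδ, hκR]; field_simp; ring
    rw [this, Nat.ceil_natCast]
  have hmre : ∀ v w : HexVertex, (hexMidpoint s(v, w)).re = ((hexCenter v).re + (hexCenter w).re) / 2 :=
    fun v w => by simp [hexMidpoint_mk, Complex.add_re]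
  have hmim : ∀ v w : HexVertex, (hexMidpoint s(v, w)).im = ((hexCenter v).im + (hexCenter w).im) / 2 :=
    fun v w => by simp [hexMidpoint_mk, Complex.add_im]
  have hfam_re : ∀ p : ℤ × ℤ, (hexMidpoint (famEdge p)).re = p.1 + 1 / 2 := by
    intro p
    rw [hfam, hmre, hre, hre]
    simp only [Pi.sub_apply, Pi.single_apply, Matrix.cons_val_zero, Matrix.cons_val_one]
    simp; ring
  have hfam_im : ∀ p : ℤ × ℤ, (hexMidpoint (famEdge p)).im = Real.sqrt 3 * p.2 := by
    intro p
    rw [hfam, hmim, him, him]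
    simp only [Pi.sub_apply, Pi.single_apply, Matrix.cons_val_one]
    simp; ring
  have hfam_inj : Function.Injective famEdge := by
    intro p q hpq
    rw [hfam, hfam, Sym2.eq_iff] at hpq
    rcases hpq with ⟨h1, -⟩ | ⟨h1, -⟩
    · have hc : (![p.1 - p.2, 2 * p.2] : Site 2) = ![q.1 - q.2, 2 * q.2] := by simpa using congrArg Prod.fst h1
      have h0 := congrFun hc 0
      have h1' := congrFun hc 1
      simp only [Matrix.cons_val_zero, Matrix.cons_val_one] at h0 h1'
      exact Prod.ext (by omega) (by omega)
    · have h01 : (0 : Fin 2) = 1 := by simpa using congrArg Prod.snd h1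
      exact absurd h01 (by decide)
  have hmem : ∀ σ : ℤ, (σ = 1 ∨ σ = -1) → ∀ p ∈ Finset.Icc (12 * κ * σ - 3 * κ) (12 * κ * σ + 3 * κ - 1) ×ˢ
      Finset.Icc (-(κ : ℤ)) κ, famEdge p ∈ hexDomainMidEdges (Lam δ) ∧
        (δ : ℂ) * hexMidpoint (famEdge p) ∈ Metric.closedBall ((3 : ℂ) * σ) 1 ∧
        Gcex (famEdge p) = (if σ = 1 then 2 else 1) := by
    intro σ hσ p hp
    simp only [Finset.mem_product, Finset.mem_Icc] at hp
    obtain ⟨⟨h1, h2⟩, h3, h4⟩ := hp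
    have hk1 : (1 : ℤ) ≤ κ := by exact_mod_cast hκ1
    have hkk : (κ : ℤ) ≤ (κ : ℤ) ^ 2 := by nlinarith
    have hκ' : (1 : ℝ) ≤ κ := by exact_mod_cast hκ1
    have hc0 : ((![p.1 - p.2, 2 * p.2] : Site 2)) 0 = p.1 - p.2 := rfl
    have hc1 : ((![p.1 - p.2, 2 * p.2] : Site 2)) 1 = 2 * p.2 := rfl
    have hcre : (hexCenter ((![p.1 - p.2, 2 * p.2] : Site 2), 0)).re = p.1 + 1 / 2 := by
      rw [hre, hc0, hc1, Fin.val_zero]; push_cast; ring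
    refine ⟨⟨?_, (![p.1 - p.2, 2 * p.2], 0), by rw [hfam]; exact Sym2.mem_mk_left _ _, ?_⟩, ?_, ?_⟩
    · -- an edge of ℍ
      rw [hfam, SimpleGraph.mem_edgeSet, ← HexGreen.mem_nbrs_iff]
      simp [HexGreen.nbrs_up]
    · -- its up face lies in `Lam δ`
      rw [hmemLam, hceil, hcre]
      refine ⟨fun i => ?_, ?_⟩
      · push_cast
        fin_cases i
        · rw [Fin.zero_eta, hc0]
          rcases hσ with rfl | rfl <;> constructor <;> nlinarith
        · rw [Fin.mk_one, hc1]
          rcases hσ with rfl | rfl <;> constructor <;> nlinarith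
      · rcases hσ with rfl | rfl
        · have : (9 : ℝ) * κ ≤ p.1 := by exact_mod_cast (show (9 : ℤ) * κ ≤ p.1 by linarith)
          rw [abs_of_nonneg (by linarith)]; linarith
        · have : (p.1 : ℝ) ≤ -9 * κ - 1 := by exact_mod_cast (show (p.1 : ℤ) ≤ -9 * κ - 1 by linarith)
          rw [abs_of_nonpos (by linarith)]; linarith
    · -- the rescaled mid-point lies in the ball about 3σ
      rw [Metric.mem_closedBall, dist_eq_norm]
      set u : ℝ := p.1 + 1 / 2 - 12 * κ * σ with hu
      have hz : (δ : ℂ) * hexMidpoint (famEdge p) - 3 * σ = ⟨δ * u, δ * (Real.sqrt 3 * p.2)⟩ := by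
        have e3 : (3 : ℝ) * σ = δ * (12 * κ * σ) := by
          calc (3 : ℝ) * σ = (δ * (4 * κ)) * (3 * σ) := by rw [hδκ]; ring
            _ = δ * (12 * κ * σ) := by ring
        apply Complex.ext
        · rw [Complex.sub_re, Complex.re_ofReal_mul, hfam_re]
          have h3σ : ((3 : ℂ) * (σ : ℂ)).re = 3 * σ := by simp
          rw [h3σ, hu, e3]; ring
        · rw [Complex.sub_im, Complex.im_ofReal_mul, hfam_im]
          have h3σ : ((3 : ℂ) * (σ : ℂ)).im = 0 := by simp
          rw [h3σ]; ring
      rw [hz]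
      have h1r : (12 * κ * σ - 3 * κ : ℝ) ≤ p.1 := by exact_mod_cast h1
      have h2r : (p.1 : ℝ) ≤ 12 * κ * σ + 3 * κ - 1 := by exact_mod_cast h2
      have h3r : (-(κ : ℝ)) ≤ p.2 := by exact_mod_cast h3
      have h4r : (p.2 : ℝ) ≤ κ := by exact_mod_cast h4
      clear h1 h2 h3 h4 hk1 hkk hcre hc0 hc1 hfam_inj hfam_im hfam_re hmre hmim hsum hmemLam hre him hG hne hdiv hz
        hfam hceil
      clear_value u
      have hu2 : u ^ 2 ≤ (3 * κ) ^ 2 := sq_le_sq' (by rw [hu]; linarith) (by rw [hu]; linarith)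
      have hw2 : (p.2 : ℝ) ^ 2 ≤ (κ : ℝ) ^ 2 := sq_le_sq' (by linarith) h4r
      have hdk : δ ^ 2 * (κ : ℝ) ^ 2 = 1 / 16 := by
        calc δ ^ 2 * (κ : ℝ) ^ 2 = (δ * (4 * κ)) ^ 2 / 16 := by ring
          _ = 1 / 16 := by rw [hδκ]; norm_num
      have hs3 : Real.sqrt 3 ^ 2 = 3 := Real.sq_sqrt (by norm_num)
      have hsq : Complex.normSq (⟨δ * u, δ * (Real.sqrt 3 * p.2)⟩ : ℂ) ≤ 1 := by
        rw [Complex.normSq_mk]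
        have e : δ * u * (δ * u) + δ * (Real.sqrt 3 * p.2) * (δ * (Real.sqrt 3 * p.2)) =
            δ ^ 2 * u ^ 2 + Real.sqrt 3 ^ 2 * (δ ^ 2 * (p.2 : ℝ) ^ 2) := by ring
        rw [e, hs3]
        nlinarith [mul_le_mul_of_nonneg_left hu2 (sq_nonneg δ), mul_le_mul_of_nonneg_left hw2 (sq_nonneg δ)]
      have hn : ‖(⟨δ * u, δ * (Real.sqrt 3 * p.2)⟩ : ℂ)‖ ^ 2 ≤ 1 := by rw [Complex.sq_norm]; exact hsq
      exact (sq_le_one_iff₀ (norm_nonneg _)).mp hn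
    · -- the value of G
      rw [hG, hfam_re]
      rcases hσ with rfl | rfl
      · have : (9 : ℝ) * κ ≤ p.1 := by exact_mod_cast (show (9 : ℤ) * κ ≤ p.1 by linarith)
        rw [if_neg (by linarith), if_pos rfl]
      · have : (p.1 : ℝ) ≤ -9 * κ - 1 := by exact_mod_cast (show (p.1 : ℤ) ≤ -9 * κ - 1 by linarith)
        rw [if_pos (by linarith), if_neg (by decide)]
  have hfin : {e | e ∈ hexDomainMidEdges (Lam δ) ∧ (δ : ℂ) * hexMidpoint e ∈ K}.Finite := by
    refine Set.Finite.subset (Finset.finite_toSet ((Lam δ).biUnion fun v => (HexGreen.nbrs v).image fun w => s(v, w))) ?_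
    rintro e ⟨⟨he, v, hve, hvΛ⟩, -⟩
    rw [Finset.mem_coe, Finset.mem_biUnion]
    refine ⟨v, hvΛ, ?_⟩; rw [Finset.mem_image]; clear hvΛ
    induction e using Sym2.ind with
    | _ a b =>
      have hab : hexGraph.Adj a b := (SimpleGraph.mem_edgeSet hexGraph).1 he
      rcases Sym2.mem_iff.1 hve with h | h <;> subst h
      · exact ⟨b, (HexGreen.mem_nbrs_iff _ _).2 hab, rfl⟩
      · exact ⟨a, (HexGreen.mem_nbrs_iff _ _).2 hab.symm, Sym2.eq_swap⟩
  have hcard : ∀ σ : ℤ, (((Finset.Icc (12 * κ * σ - 3 * κ) (12 * κ * σ + 3 * κ - 1) ×ˢ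
      Finset.Icc (-(κ : ℤ)) κ).card : ℝ)) = 6 * κ * (2 * κ + 1) := by
    intro σ
    rw [Finset.card_product, Int.card_Icc, Int.card_Icc]
    have e1 : (12 * κ * σ + 3 * κ - 1 + 1 - (12 * κ * σ - 3 * κ)).toNat = 6 * κ := by omega
    have e2 : ((κ : ℤ) + 1 - -(κ : ℤ)).toNat = 2 * κ + 1 := by omega
    rw [e1, e2]; push_cast; ring
  have hlow : ∀ σ : ℤ, (σ = 1 ∨ σ = -1) → ∀ t : ℝ, (∀ p ∈ Finset.Icc (12 * κ * σ - 3 * κ) (12 * κ * σ + 3 * κ - 1) ×ˢ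
      Finset.Icc (-(κ : ℤ)) κ, t ≤ |‖Gcex (famEdge p)‖ / s - 1|) →
      6 * κ * (2 * κ + 1) * t ≤ ∑ᶠ e ∈ {e | e ∈ hexDomainMidEdges (Lam δ) ∧ (δ : ℂ) * hexMidpoint e ∈ K},
        |‖Gcex e‖ / s - 1| := by
    intro σ hσ t ht
    have hKσ : Metric.closedBall ((3 : ℂ) * σ) 1 ⊆ K := by
      rcases hσ with rfl | rfl
      · rw [Int.cast_one, mul_one]; exact Set.subset_union_right
      · rw [Int.cast_neg, Int.cast_one, mul_neg, mul_one]; exact Set.subset_union_left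
    rw [finsum_mem_eq_finite_toFinset_sum _ hfin]
    calc 6 * (κ : ℝ) * (2 * κ + 1) * t
        = ∑ _p ∈ Finset.Icc (12 * κ * σ - 3 * κ) (12 * κ * σ + 3 * κ - 1) ×ˢ Finset.Icc (-(κ : ℤ)) κ, t := by
          rw [Finset.sum_const, nsmul_eq_mul, hcard]
      _ ≤ ∑ p ∈ Finset.Icc (12 * κ * σ - 3 * κ) (12 * κ * σ + 3 * κ - 1) ×ˢ Finset.Icc (-(κ : ℤ)) κ,
            |‖Gcex (famEdge p)‖ / s - 1| := Finset.sum_le_sum ht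
      _ = ∑ e ∈ (Finset.Icc (12 * κ * σ - 3 * κ) (12 * κ * σ + 3 * κ - 1) ×ˢ Finset.Icc (-(κ : ℤ)) κ).image famEdge,
            |‖Gcex e‖ / s - 1| := (Finset.sum_image (f := fun e => |‖Gcex e‖ / s - 1|) (fun x _ y _ hxy => hfam_inj hxy)).symm
      _ ≤ _ := by
          apply Finset.sum_le_sum_of_subset_of_nonneg
          · intro e he
            rw [Finset.mem_image] at he
            obtain ⟨p, hp, rfl⟩ := he
            rw [Set.Finite.mem_toFinset]
            exact ⟨(hmem σ hσ p hp).1, hKσ (hmem σ hσ p hp).2.1⟩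
          · intro e _ _; exact abs_nonneg _
  have hκ1R : (1 : ℝ) ≤ κ := by exact_mod_cast hκ1
  have h16 : δ ^ 2 = (16 * (κ : ℝ) ^ 2)⁻¹ := by rw [hδ, hκR]; field_simp; ring
  by_cases hs85 : s ≤ 8 / 5
  · have ht : 1 / 4 ≤ 2 / s - 1 := by
      have : 5 / 4 ≤ 2 / s := by rw [le_div_iff₀ hs]; linarith
      linarith
    have hS := hlow 1 (Or.inl rfl) (2 / s - 1) (fun p hp => by
      rw [(hmem 1 (Or.inl rfl) p hp).2.2, if_pos rfl, Complex.norm_ofNat]; exact le_abs_self _)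
    have h2 := (mul_le_mul_of_nonneg_left hS (sq_nonneg δ)).trans hsum
    rw [h16, inv_mul_le_iff₀ (by positivity)] at h2
    nlinarith [mul_nonneg (by positivity : (0 : ℝ) ≤ 6 * κ * (2 * κ + 1)) (sub_nonneg.2 ht)]
  · push Not at hs85
    have ht : 3 / 8 ≤ 1 - 1 / s := by
      have : 1 / s ≤ 5 / 8 := by rw [div_le_iff₀ hs]; linarith
      linarith
    have hS := hlow (-1) (Or.inr rfl) (1 - 1 / s) (fun p hp => by
      rw [(hmem (-1) (Or.inr rfl) p hp).2.2, if_neg (by decide), norm_one]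
      have := neg_le_abs (1 / s - 1); linarith)
    have h2 := (mul_le_mul_of_nonneg_left hS (sq_nonneg δ)).trans hsum
    rw [h16, inv_mul_le_iff₀ (by positivity)] at h2
    nlinarith [mul_nonneg (by positivity : (0 : ℝ) ≤ 6 * κ * (2 * κ + 1)) (sub_nonneg.2 ht)]

end Summit.CriticalPhenomena.SAWScalingLimit.Theorems
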